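import Mathlib
import HarnessLib
import Literature.Probability.MarkovChains.MetropolisHastings
import Summits.Ventures.LatticeQCDFlow.Exactness.LocalUpdates
import Summits.Ventures.LatticeQCDFlow.Exactness.HeatBath
import Summits.Ventures.LatticeQCDFlow.Exactness.KernelMixture

/-!
# Heat-bath kernels are positive: the Dirichlet-type quadratic form of a block heat bath is a sum of squares

HONEST FRAMING: exact (Metropolis-corrected) sampling algorithms for lattice gauge theory;
figures of merit are autocorrelation/cost numbers at stated couplings and volumes; no
continuum-physics claim.

Venture `LatticeQCDFlow` (cell pub-lqcd), topic `Exactness`; FANOUT row 9 (`eng-latcore`).  NEW WORK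
of the cell (elementary finite sums); the printed names (positivity of Gibbs / heat-bath operators,
random-scan samplers) appear in docstrings only, nothing is cited as a fact.

## Content

For a weight `π` on a finite `Z`, a kernel `K` and a test function `f` put
`qform π K f = ∑ a b, π a · f a · K a b · f b` (= `⟨f, K f⟩` in `ℓ²(π)` when `K` is `π`-reversible).

* `qform_blockKernel` — for a frozen-block kernel on `X × Y` the form splits over the frozen
  coordinate: `∑ y, ∑ x x', π (x,y) f (x,y) T y x x' f (x',y)`;
* `qform_heatBathKernel` — for the block HEAT BATH (`HeatBath.lean`) it is a SUM OF SQUARES,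
  `∑ y, (∑ x, π (x,y) f (x,y))² / Z y`; hence `qform_heatBathKernel_nonneg` for `π ≥ 0`: the heat
  bath is a POSITIVE kernel (it is the `π`-orthogonal projection onto functions of `y` alone —
  `heatBathRow_idempotent` is the same fact seen as `K ∘ K = K`);
* `qform_mixKernel` — the form is linear in the kernel, so a state-independent mixture
  (`KernelMixture.lean`) of positive kernels with non-negative weights is positive
  (`qform_mixKernel_nonneg`): random-scan heat-bath sweeps are positive kernels.

Dictionary / why the engine cares: a positive reversible kernel has spectrum in `[0, 1]`, so its
autocorrelations at every lag are non-negative — pure heat-bath / random-scan Gibbs dynamics can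
only be accelerated by changing the moves, not by cancellation; the deterministic involutions the
engine interleaves (over-relaxation, `OverHeatBath.lean`) are exactly the non-positive ingredients.
This file is the finite algebraic core of that statement; spectra are not developed here.
-/

namespace Summit.Ventures.LatticeQCDFlow.Exactness

open Finset
open Literature.Probability.MarkovChains

/-- The quadratic form `∑ a b, π a · f a · K a b · f b` of a kernel against a test function. -/
noncomputable def qform {Z : Type*} [Fintype Z] (π : Z → ℝ) (K : Z → Z → ℝ) (f : Z → ℝ) : ℝ :=
  ∑ a, ∑ b, π a * f a * K a b * f b

section Block

variable {X Y : Type*} [Fintype X] [Fintype Y] [DecidableEq Y]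

/-- For a frozen-block kernel the form splits over the frozen coordinate. -/
theorem qform_blockKernel (π : X × Y → ℝ) (T : Y → X → X → ℝ) (f : X × Y → ℝ) :
    qform π (blockKernel T) f = ∑ y, ∑ x, ∑ x', π (x, y) * f (x, y) * T y x x' * f (x', y) := by
  unfold qform
  rw [Fintype.sum_prod_type, Finset.sum_comm]
  refine sum_congr rfl fun y _ => sum_congr rfl fun x _ => ?_
  rw [Fintype.sum_prod_type]
  refine sum_congr rfl fun x' _ => ?_
  rw [Finset.sum_eq_single y]
  · simp [blockKernel]
  · intro y' _ h
    simp [blockKernel, h]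
  · intro h
    exact absurd (mem_univ y) h

/-- **The block heat bath's form is a sum of squares**: `∑ y, (∑ x, π (x,y) f (x,y))² / Z y`. -/
theorem qform_heatBathKernel (π : X × Y → ℝ) (f : X × Y → ℝ) :
    qform π (heatBathKernel π) f = ∑ y, (∑ x, π (x, y) * f (x, y)) ^ 2 / condZ π y := by
  rw [heatBathKernel, qform_blockKernel]
  refine sum_congr rfl fun y _ => ?_
  have h : ∀ x x', π (x, y) * f (x, y) * heatBathRow π y x x' * f (x', y) =
      (π (x, y) * f (x, y)) * (π (x', y) * f (x', y)) / condZ π y := by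
    intro x x'
    simp only [heatBathRow]
    ring
  simp_rw [h]
  rw [sq, Finset.sum_mul_sum, Finset.sum_div]
  refine sum_congr rfl fun x _ => ?_
  rw [Finset.sum_div]

/-- **The block heat bath is a positive kernel** for a non-negative weight. -/
theorem qform_heatBathKernel_nonneg {π : X × Y → ℝ} (hπ : ∀ a, 0 ≤ π a) (f : X × Y → ℝ) :
    0 ≤ qform π (heatBathKernel π) f := by
  rw [qform_heatBathKernel]
  exact sum_nonneg fun y _ => div_nonneg (sq_nonneg _) (sum_nonneg fun x _ => hπ (x, y))

end Block

section Mixture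

variable {Z ι : Type*} [Fintype Z] [Fintype ι]

/-- The form is linear in the kernel: a state-independent mixture mixes the forms. -/
theorem qform_mixKernel (π : Z → ℝ) (w : ι → ℝ) (K : ι → Z → Z → ℝ) (f : Z → ℝ) :
    qform π (mixKernel w K) f = ∑ i, w i * qform π (K i) f := by
  unfold qform mixKernel
  have h : ∀ a b, π a * f a * (∑ i, w i * K i a b) * f b = ∑ i, w i * (π a * f a * K i a b * f b) := by
    intro a b
    simp only [Finset.mul_sum, Finset.sum_mul]
    exact sum_congr rfl fun i _ => by ring
  simp_rw [h]
  -- ∑ a, ∑ b, ∑ i, g i a b = ∑ i, w i * ∑ a, ∑ b, (...)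
  calc ∑ a, ∑ b, ∑ i, w i * (π a * f a * K i a b * f b)
      = ∑ a, ∑ i, ∑ b, w i * (π a * f a * K i a b * f b) := sum_congr rfl fun a _ => Finset.sum_comm
    _ = ∑ i, ∑ a, ∑ b, w i * (π a * f a * K i a b * f b) := Finset.sum_comm
    _ = ∑ i, w i * ∑ a, ∑ b, π a * f a * K i a b * f b := by
        refine sum_congr rfl fun i _ => ?_
        simp only [Finset.mul_sum]

/-- **Mixtures of positive kernels are positive** (non-negative weights): e.g. a random-scan sweep
of block heat baths. -/
theorem qform_mixKernel_nonneg {π : Z → ℝ} {w : ι → ℝ} (hw : ∀ i, 0 ≤ w i) {K : ι → Z → Z → ℝ}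
    {f : Z → ℝ} (hK : ∀ i, 0 ≤ qform π (K i) f) : 0 ≤ qform π (mixKernel w K) f := by
  rw [qform_mixKernel]
  exact sum_nonneg fun i _ => mul_nonneg (hw i) (hK i)

end Mixture

end Summit.Ventures.LatticeQCDFlow.Exactness
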